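import Literature.AlgebraicGeometry.Frobenioids.CategoriesSchemaNegative
import Literature.AnabelianGeometry.SemiGraphs.QuasiTemperoidsPropA2Proofs2
import HarnessLib

/-!
# Semi-graphs of anabelioids, Appendix: Definition A.1 (ii) — nondegenerate objects
# (kernel closure census of the predicate `IsNondegenerateObj`)

Mochizuki, *Semi-graphs of anabelioids*, Publ. RIMS **42** (2006) 221–322, Appendix
"Quasi-temperoids", Definition A.1 (ii), manuscript p. 79 [cite: MochizukiSemiAnbd2006, Def A.1(ii) p.79]:
"An object `A` of a quasi-temperoid `Q` will be called *nondegenerate* if, for every connected object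
`B` of `Q`, there exist arrows `C → B`, `C → A`, for some connected object `C` of `Q`."

PROOF-ONLY companion of `QuasiTemperoids.lean` (no definitions). The declaration `IsNondegenerateObj`
is a PREDICATE on objects (a definition, [SemiAnbd] Def. A.1 (ii)), not a published theorem; it sits
in the abc-iut cell's frozen fact list as row F-1614 (labelled "witness-candidate" by a
conclusion-head match). This file records in the kernel what there is to know about it:

* `IsNondegenerateObj.of_hom` / `.of_iso` — nondegeneracy passes along arrows `A → A'` (any category);
* in a CONNECTED quasi-temperoid the nondegenerate objects are exactly the nonempty [non-initial]
  ones (`IsConnectedQuasiTemperoid.isNondegenerateObj_iff_isNonemptyObj`; this is the one-factor case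
  of Prop. A.2 (iii), assembled from the landed `isNonemptyObj_of_isNondegenerateObj` and
  `exists_isConnectedObj_hom_hom`); in particular connected objects are nondegenerate and empty
  [initial] objects are NOT (`IsConnectedQuasiTemperoid.not_isNondegenerateObj_of_isInitial`);
* hence the UNIVERSAL CLOSURE of the predicate is FALSE (`not_forall_isNondegenerateObj`; the cheapest
  kernel witness is the empty type in the category of types, where the one-point type is connected),
  so the row is a schema to be used at instances, not an assumption to bind unapplied.

Nothing here bears on, or takes a side on, [IUTchIII] Cor. 3.12; typed ≠ proved.
-/

open CategoryTheory CategoryTheory.Limits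

namespace Literature.AnabelianGeometry.SemiGraphs

open Literature.AlgebraicGeometry.Frobenioids (IsConnectedObj IsNonemptyObj isNonemptyObj_type_iff)
open Literature.AlgebraicGeometry.Frobenioids.QuasiTemperoid (IsConnectedQuasiTemperoid)

universe v₁ u₁ u

/-! ### Any category -/

section AnyCategory

variable {Q : Type u₁} [Category.{v₁} Q]

/-- Nondegeneracy passes along arrows: if `A` is nondegenerate and `A → A'`, then `A'` is
nondegenerate (compose `C → A → A'`). [cite: MochizukiSemiAnbd2006, Def A.1(ii) p.79] -/
theorem IsNondegenerateObj.of_hom {A A' : Q} (f : A ⟶ A') (h : IsNondegenerateObj A) :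
    IsNondegenerateObj A' := fun B hB => by
  obtain ⟨C, hC, hCB, ⟨g⟩⟩ := h B hB
  exact ⟨C, hC, hCB, ⟨g ≫ f⟩⟩

/-- Nondegeneracy is invariant under isomorphism. [cite: MochizukiSemiAnbd2006, Def A.1(ii) p.79] -/
theorem IsNondegenerateObj.of_iso {A A' : Q} (e : A ≅ A') (h : IsNondegenerateObj A) :
    IsNondegenerateObj A' :=
  h.of_hom e.hom

/-- In a category WITHOUT connected objects every object is (vacuously) nondegenerate — the predicate
only has content where connected objects exist (as in quasi-temperoids).
[cite: MochizukiSemiAnbd2006, Def A.1(ii) p.79] -/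
theorem isNondegenerateObj_of_forall_not_isConnectedObj (hQ : ∀ B : Q, ¬ IsConnectedObj B) (A : Q) :
    IsNondegenerateObj A := fun B hB => absurd hB (hQ B)

end AnyCategory

/-! ### Connected quasi-temperoids: nondegenerate = nonempty (Prop. A.2 (iii), one factor) -/

section ConnectedQuasiTemperoid

variable {Q : Type u₁} [Category.{v₁} Q]

/-- In a connected quasi-temperoid an object is nondegenerate iff it is nonempty [non-initial]:
(⇒) it is dominated, together with a connected object, by a connected — hence nonempty — object and
initial objects are strict; (⇐) a nonempty `A` and a connected `B` are dominated by a common connected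
object (a coset object `Π/(Stab a ∩ Stab b)` in a chart). This is Prop. A.2 (iii) for a one-member
family. [cite: MochizukiSemiAnbd2006, Prop A.2(iii) p.80] -/
theorem _root_.Literature.AlgebraicGeometry.Frobenioids.QuasiTemperoid.IsConnectedQuasiTemperoid.isNondegenerateObj_iff_isNonemptyObj
    (hQ : IsConnectedQuasiTemperoid.{v₁, u₁, u} Q) (A : Q) :
    IsNondegenerateObj A ↔ IsNonemptyObj A :=
  ⟨fun hA => hQ.isNonemptyObj_of_isNondegenerateObj hA,
    fun hA _ hB => hQ.exists_isConnectedObj_hom_hom hB.1 hA⟩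

/-- In a connected quasi-temperoid every connected object is nondegenerate.
[cite: MochizukiSemiAnbd2006, Def A.1(ii) p.79] -/
theorem _root_.Literature.AlgebraicGeometry.Frobenioids.QuasiTemperoid.IsConnectedQuasiTemperoid.isNondegenerateObj_of_isConnectedObj
    (hQ : IsConnectedQuasiTemperoid.{v₁, u₁, u} Q) {A : Q} (hA : IsConnectedObj A) :
    IsNondegenerateObj A :=
  (hQ.isNondegenerateObj_iff_isNonemptyObj A).mpr hA.1

/-- In a connected quasi-temperoid an empty [initial] object is NOT nondegenerate (cf. Remark A.1.2:
"the functor `Q → Q` that maps all objects of `Q` to some empty object … fails to preserve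
nondegenerate objects"). [cite: MochizukiSemiAnbd2006, Rmk A.1.2 p.80] -/
theorem _root_.Literature.AlgebraicGeometry.Frobenioids.QuasiTemperoid.IsConnectedQuasiTemperoid.not_isNondegenerateObj_of_isInitial
    (hQ : IsConnectedQuasiTemperoid.{v₁, u₁, u} Q) {E : Q} (hE : IsInitial E) :
    ¬ IsNondegenerateObj E :=
  fun h => (hQ.isNonemptyObj_of_isNondegenerateObj h).false hE

/-- In a connected quasi-temperoid the initial object `⊥` is not nondegenerate — so NOT every object of
a quasi-temperoid is nondegenerate. [cite: MochizukiSemiAnbd2006, Rmk A.1.2 p.80] -/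
theorem _root_.Literature.AlgebraicGeometry.Frobenioids.QuasiTemperoid.IsConnectedQuasiTemperoid.not_isNondegenerateObj_initial
    (hQ : IsConnectedQuasiTemperoid.{v₁, u₁, u} Q) :
    haveI := hQ.hasInitial; ¬ IsNondegenerateObj (⊥_ Q) :=
  haveI := hQ.hasInitial; hQ.not_isNondegenerateObj_of_isInitial initialIsInitial

end ConnectedQuasiTemperoid

/-! ### The cheapest kernel witness against the universal closure: the category of types -/

section Types

/-- In the category of types the one-point type is connected: it is inhabited, and were
`B₁ → pt ← B₂` a coproduct diagram with `B₁`, `B₂` inhabited, the two constant maps `B₁ → {0,1}`,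
`B₂ → {0,1}` with different values would factor through the point. [cite: MochizukiFrdI2008, §0 p.15] -/
theorem types_isConnectedObj_punit : IsConnectedObj (PUnit.{u + 1} : Type u) := by
  refine ⟨(isNonemptyObj_type_iff _).mpr ⟨PUnit.unit⟩, fun B₁ B₂ ι₁ ι₂ h₁ h₂ => ⟨fun hc => ?_⟩⟩
  obtain ⟨b₁⟩ := (isNonemptyObj_type_iff B₁).mp h₁
  obtain ⟨b₂⟩ := (isNonemptyObj_type_iff B₂).mp h₂
  let s : BinaryCofan B₁ B₂ :=
    BinaryCofan.mk (P := ULift.{u} Bool) (↾fun _ => ULift.up true) (↾fun _ => ULift.up false)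
  have e₁ : (ι₁ ≫ hc.desc s) b₁ = ULift.up true :=
    types_congr_hom (hc.fac s ⟨WalkingPair.left⟩) b₁
  have e₂ : (ι₂ ≫ hc.desc s) b₂ = ULift.up false :=
    types_congr_hom (hc.fac s ⟨WalkingPair.right⟩) b₂
  rw [types_comp_apply] at e₁ e₂
  rw [Subsingleton.elim (ι₁ b₁) (ι₂ b₂), e₂] at e₁
  exact Bool.false_ne_true (congrArg ULift.down e₁)

/-- In the category of types the empty type is NOT nondegenerate: no connected (hence inhabited)
type maps to it, while the connected one-point type would require one.
[cite: MochizukiSemiAnbd2006, Def A.1(ii) p.79] -/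
theorem types_not_isNondegenerateObj_pempty : ¬ IsNondegenerateObj (PEmpty.{u + 1} : Type u) := by
  intro h
  obtain ⟨C, hC, -, ⟨g⟩⟩ := h PUnit types_isConnectedObj_punit
  obtain ⟨c⟩ := (isNonemptyObj_type_iff C).mp hC.1
  exact (g c).elim

/-- F-1614 is a PREDICATE, not a theorem: its universal closure ("every object of every category is
nondegenerate") is FALSE — witness the empty type in the category of types (and, in the paper's own
setting, any empty object of a connected quasi-temperoid,
`IsConnectedQuasiTemperoid.not_isNondegenerateObj_of_isInitial`).
[cite: MochizukiSemiAnbd2006, Def A.1(ii) p.79] -/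
theorem not_forall_isNondegenerateObj :
    ¬ ∀ (Q : Type (u + 1)) [Category.{u} Q] (A : Q), IsNondegenerateObj A :=
  fun h => types_not_isNondegenerateObj_pempty.{u} (h (Type u) PEmpty)

end Types

end Literature.AnabelianGeometry.SemiGraphs
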